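import Summits.KontsevichZagierPeriods.KontsevichZagierPeriods.Theses.DessinsDimensionOne
import Literature.NumberTheory.Transcendental.KZRelationsLE

/-!
# `ExcursionBudgetOfStrata` (stmt-KontsevichZagierPeriods-18967, route DessinsDimensionOne) — proof

`ExcursionBudgetOfStrata : KZDimTwo → DimensionStep → OneAuxiliaryVariable → ExcursionBudget` is the
split glue of the deciding crux `ExcursionBudget` (stmt-KontsevichZagierPeriods-6259: for every `d`,
equal-valued KZ-rational representations of dimensions `≤ d` differ by an element of `relations_≤(d+1)`,
"one auxiliary variable suffices") into the dimension-two stratum `KZDimTwo` (Conjecture 1 on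
dimensions `≤ 2`), the conditional transcendence input `DimensionStep` (for `d ≥ 2`, layer `d` of
`ExcursionBudget` implies Conjecture 1 on the stratum `≤ d + 1`) and the conservativity defect
`OneAuxiliaryVariable` (`relations ⊓ formalRep_≤d ≤ relations_≤(d+1)`).

Proof (an interleaved induction on `d`, not a one-line seam). Write *Layer d* for layer `d` of
`ExcursionBudget` and *Stratum d* for Conjecture 1 on dimensions `≤ d`. (i) Stratum `d` for `d ≤ 2`
is `KZDimTwo` (`stratum_of_le_two`); (ii) at every level `OneAuxiliaryVariable` turns Stratum `d` into
Layer `d`, because `[r] − [r']` lies in `formalRep_≤d` (`KZ.of_mem_formalRepLE`) and in `relations`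
(`layer_of_stratum`); (iii) for `d ≥ 2`, `DimensionStep` turns Layer `d` into Stratum `d + 1`;
induction on `d` with the case split `d + 1 < 3` / `≥ 3` (`layer_all`). The inlined truncations of the
route file are `KZ.formalRepLE d` and `KZ.relationsLE (d + 1)` by `rfl`. Strategist-proved glue
(`Cruxes/ExcursionBudget/DECOMPOSITION.md`, theorem `excursionBudget_of_subs`), landed by lead c10 of
crux stmt-KontsevichZagierPeriods-9129 (banking). Source: M. Kontsevich, D. Zagier, *Periods* (2001),
§1.2 (rules (1)–(3), Conjecture 1, Problem 2).
-/

open Literature.NumberTheory.Transcendental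

namespace Summit.KontsevichZagierPeriods.DessinsDimensionOne

open Summit.KontsevichZagierPeriods.KontsevichZagierPeriods.Theses.DessinsDimensionOne

/-- **Stratum ⇒ Layer.** `OneAuxiliaryVariable` turns Conjecture 1 on the stratum of dimensions `≤ d`
into layer `d` of `ExcursionBudget`: `[r] − [r']` is a relation (the stratum) supported in dimension
`≤ d` (`KZ.of_mem_formalRepLE`), hence a truncated relation inside dimension `d + 1`. [folklore] -/
theorem layer_of_stratum (h₃ : OneAuxiliaryVariable) {d : ℕ}
    (hS : ∀ ⦃n m : ℕ⦄, n ≤ d → m ≤ d → ∀ (r : KZ.IntegralRep n) (r' : KZ.IntegralRep m),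
      r.IsRational → r'.IsRational → r.value = r'.value → KZ.Equivalent r r') :
    ∀ ⦃n m : ℕ⦄, n ≤ d → m ≤ d → ∀ (r : KZ.IntegralRep n) (r' : KZ.IntegralRep m),
      r.IsRational → r'.IsRational → r.value = r'.value →
        KZ.of r - KZ.of r' ∈ KZ.relationsLE (d + 1) := by
  intro n m hn hm r r' hr hr' hv
  exact h₃ d _ (hS hn hm r r' hr hr' hv)
    (sub_mem (KZ.of_mem_formalRepLE r hn) (KZ.of_mem_formalRepLE r' hm))

/-- **The low strata.** Conjecture 1 on the stratum of dimensions `≤ d`, `d ≤ 2`, is (a restriction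
of) the dimension-two stratum `KZDimTwo`. [folklore] -/
theorem stratum_of_le_two (h₁ : KZDimTwo) {d : ℕ} (hd : d ≤ 2) :
    ∀ ⦃n m : ℕ⦄, n ≤ d → m ≤ d → ∀ (r : KZ.IntegralRep n) (r' : KZ.IntegralRep m),
      r.IsRational → r'.IsRational → r.value = r'.value → KZ.Equivalent r r' :=
  fun _ _ hn hm r r' hr hr' hv => h₁ (hn.trans hd) (hm.trans hd) r r' hr hr' hv

/-- **All layers**, by the interleaved induction on `d`: layers `0, 1, 2` from `KZDimTwo` through
`OneAuxiliaryVariable`; for `d + 1 ≥ 3`, `DimensionStep` turns layer `d` (induction hypothesis) into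
the stratum `≤ d + 1`, and `OneAuxiliaryVariable` turns that stratum into layer `d + 1`. [folklore] -/
theorem layer_all (h₁ : KZDimTwo) (h₂ : DimensionStep) (h₃ : OneAuxiliaryVariable) (d : ℕ) :
    ∀ ⦃n m : ℕ⦄, n ≤ d → m ≤ d → ∀ (r : KZ.IntegralRep n) (r' : KZ.IntegralRep m),
      r.IsRational → r'.IsRational → r.value = r'.value →
        KZ.of r - KZ.of r' ∈ KZ.relationsLE (d + 1) := by
  induction d with
  | zero => exact layer_of_stratum h₃ (stratum_of_le_two h₁ (Nat.zero_le 2))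
  | succ d ih =>
    rcases Nat.lt_or_ge (d + 1) 3 with hd | hd
    · exact layer_of_stratum h₃ (stratum_of_le_two h₁ (Nat.lt_succ_iff.mp hd))
    · have hd2 : 2 ≤ d := by omega
      have hS : ∀ ⦃n m : ℕ⦄, n ≤ d + 1 → m ≤ d + 1 → ∀ (r : KZ.IntegralRep n)
          (r' : KZ.IntegralRep m), r.IsRational → r'.IsRational → r.value = r'.value →
            KZ.Equivalent r r' := fun n m hn hm r r' hr hr' hv =>
        h₂ d hd2 (fun n m hn hm r r' hr hr' hv => ih hn hm r r' hr hr' hv) hn hm r r' hr hr' hv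
      exact layer_of_stratum h₃ hS

/-- **`ExcursionBudgetOfStrata`** (route DessinsDimensionOne, stmt-KontsevichZagierPeriods-18967):
`KZDimTwo → DimensionStep → OneAuxiliaryVariable → ExcursionBudget` — layer `d` of `ExcursionBudget`
is `layer_all d` (its inlined truncation is `KZ.relationsLE (d + 1)` by `rfl`). [folklore] -/
theorem excursionBudgetOfStrata_proof :
    Summit.KontsevichZagierPeriods.KontsevichZagierPeriods.Theses.DessinsDimensionOne.ExcursionBudgetOfStrata :=
  fun h₁ h₂ h₃ d _ _ hn hm r r' hr hr' hv => layer_all h₁ h₂ h₃ d hn hm r r' hr hr' hv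

end Summit.KontsevichZagierPeriods.DessinsDimensionOne
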